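import Mathlib
import Summits.ValiantsHypothesis.ValiantsHypothesis.Theorems.FifoMatchingNNLinearDegreeCofactorHardPopCountAntiConcentration
import HarnessLib

/-!
# Crux `NNLinearDegreeCofactorHard` (stmt-ValiantsHypothesis-23918), line `internal_cofactor`, rung S11
# (stmt-ValiantsHypothesis-24468): the GATE WEIGHT — windowed anti-concentration in conditional-probability form

LEAD-HANDOFF §p5, next unit 2 (piece (B‴-b) of `Lines/internal_cofactor-S2b-D3plan.md` in the form the composition (F‴)
consumes through `CondProb.sum_prod_condWeight_le_one`).  A GATE of the dichotomy (D‴) is a past-chosen window of `ℓ`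
consecutive middle pairs `s, …, s+ℓ-1` of the bit string `v : Fin (2J) → Bool` (pair `j` ↔ bits `2j, 2j+1`), with
past-chosen decoder kinds `κ (s+i)` (inflation: the pair pops iff its two bits differ; neutral: it pops once per `false`
bit) and a past-chosen target `k` for the window's total pop count.  This file prices such a window:

* `popPair`, `levelCount` — the pop count of one pair and the number of window contents of given kinds with total pop
  count `k` (recursive definition); `levelCount_eq` — closed form `2^{#inflate} · C(#inflate + 2·#neutral, k)`;
  `succ_mul_levelCount_sq_le` — ANTI-CONCENTRATION `(ℓ+1) · levelCount² ≤ 16^ℓ` (from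
  `PopCount.succ_mul_choose_sq_le`): every level set of the window pop count has conditional mass `≤ (ℓ+1)^{-1/2}`.
* `gateWeight κ s ℓ k t v` — the conditional weight of pair `s+t`: the ratio `N_{t+1}(v) / N_t(v)` of the numbers of
  admissible completions of the window after / before reading pair `s+t` (`0` if `N_t = 0`);
  `gateWeight_eq_of_agree` — it depends on `v` only through the bits `< 2(s+t)+2` (past-measurable);
  `sum_gateWeight_setPair_le` — over the four codes of pair `s+t` it sums to `≤ 1` (conditional sub-probability);
  `prod_gateWeight_eq` — on a word whose window pop count IS `k` the weights telescope to `1 / levelCount`;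
  `sqrt_div_le_prod_gateWeight` — hence the product is `≥ √(ℓ+1) / 4^ℓ` there: plugged into
  `CondProb.card_mul_le_one_of_condWeight` with free pairs at `1/4`, a passed gate of length `ℓ` costs the word set a
  factor `(ℓ+1)^{-1/2}`.

Honest framing: elementary counting for ONE ingredient of the exponent-2 rung S11; S11 does not close stmt-23918 (∀c);
nothing here bears on `NNDivisionHard`, `NNNotVP` or VP ≠ VNP.  Definitions: the bookkeeping functions `popPair`,
`levelCount`, `bit`, `popPrefix`, `kinds`, `completions`, `gateWeight`; no named facts.
-/

noncomputable section

-- Sub = Summit single-conjunct layout: the duplicated namespace component is mandated by the tree.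
set_option linter.dupNamespace false

namespace Summit.ValiantsHypothesis.ValiantsHypothesis.Theorems.FifoMatching.NNLinearDegreeCofactorHard.GateWeight

open Finset

/-! ### Pop counts of pairs and their level counts -/

/-- The number of pops of ONE decoded pair with bits `b₀ b₁`: an inflation pair (`κ = true`, decoder
`00 ↦ UU, 01 ↦ UD, 10 ↦ DU, 11 ↦ UU`) pops iff its bits differ; a neutral pair pops once per `false` bit. [folklore] -/
def popPair (κ b₀ b₁ : Bool) : ℕ :=
  if κ then (if b₀ = b₁ then 0 else 1) else ((if b₀ then 0 else 1) + (if b₁ then 0 else 1))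

/-- The number of contents of pairs of kinds `κs` (in order) whose total pop count is `k`. [folklore] -/
def levelCount : List Bool → ℕ → ℕ
  | [], k => if k = 0 then 1 else 0
  | κ :: κs, k => ∑ c : Bool × Bool, if popPair κ c.1 c.2 ≤ k then levelCount κs (k - popPair κ c.1 c.2) else 0

/-- The sum over the four codes, written out. [folklore] -/
theorem sum_bool_prod {M : Type*} [AddCommMonoid M] (f : Bool × Bool → M) :
    ∑ c : Bool × Bool, f c = f (false, false) + f (false, true) + f (true, false) + f (true, true) := by
  rw [Fintype.sum_prod_type]; simp only [Fintype.sum_bool]; abel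

/-- One step of the recursion for an INFLATION pair: `N(κs⁺, k) = 2 N(κs, k) + 2 N(κs, k-1)`. [folklore] -/
theorem levelCount_cons_true (κs : List Bool) (k : ℕ) :
    levelCount (true :: κs) k = 2 * levelCount κs k + 2 * (if 1 ≤ k then levelCount κs (k - 1) else 0) := by
  rw [levelCount, sum_bool_prod]
  simp only [popPair, if_true]
  simp
  split_ifs <;> omega

/-- One step of the recursion for a NEUTRAL pair: `N(κs⁺, k) = N(κs, k) + 2 N(κs, k-1) + N(κs, k-2)`. [folklore] -/
theorem levelCount_cons_false (κs : List Bool) (k : ℕ) :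
    levelCount (false :: κs) k = levelCount κs k + 2 * (if 1 ≤ k then levelCount κs (k - 1) else 0)
      + (if 2 ≤ k then levelCount κs (k - 2) else 0) := by
  rw [levelCount, sum_bool_prod]
  simp only [popPair]
  simp
  split_ifs <;> omega

/-- **Closed form**: with `a` inflation pairs and `b` neutral pairs, the number of contents with pop count `k` is
`2^a · C(a + 2b, k)` (after `(b₀, b₁) ↦ (b₀, b₀ ⊕ b₁)` on inflation pairs and complementing neutral bits, the pop
count is the number of ones among `a + 2b` of the `2a + 2b` bits). [folklore] -/
theorem levelCount_eq (κs : List Bool) (k : ℕ) :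
    levelCount κs k = 2 ^ (κs.count true) * Nat.choose (κs.count true + 2 * κs.count false) k := by
  induction κs generalizing k with
  | nil =>
    simp only [levelCount, List.count_nil, pow_zero, one_mul, mul_zero, add_zero]
    cases k with
    | zero => simp
    | succ k => simp
  | cons κ κs ih =>
    cases κ with
    | true =>
      rw [levelCount_cons_true, ih, List.count_cons_self,
        List.count_cons_of_ne (by decide : (true : Bool) ≠ false)]
      set a := κs.count true
      set b := κs.count false
      cases k with
      | zero => simp [pow_succ]; ring
      | succ k =>
        rw [if_pos (by omega), ih, Nat.add_sub_cancel,
          show a + 1 + 2 * b = (a + 2 * b) + 1 by ring, Nat.choose_succ_succ', pow_succ]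
        ring
    | false =>
      rw [levelCount_cons_false, ih, List.count_cons_of_ne (by decide : (false : Bool) ≠ true),
        List.count_cons_self]
      set a := κs.count true
      set b := κs.count false
      rw [show a + 2 * (b + 1) = (a + 2 * b) + 1 + 1 by ring]
      cases k with
      | zero => simp
      | succ k =>
        rw [if_pos (by omega), ih, Nat.add_sub_cancel]
        cases k with
        | zero => simp; ring
        | succ k =>
          rw [if_pos (by omega), ih, show k + 1 + 1 - 2 = k by omega, Nat.choose_succ_succ' (a + 2 * b + 1) (k + 1),
            Nat.choose_succ_succ' (a + 2 * b) k, Nat.choose_succ_succ' (a + 2 * b) (k + 1)]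
          ring

/-- `#true + #false = length`. [folklore] -/
theorem count_true_add_count_false (κs : List Bool) : κs.count true + κs.count false = κs.length := by
  induction κs with
  | nil => simp
  | cons κ κs ih =>
    cases κ
    · rw [List.count_cons_of_ne (by decide : (false : Bool) ≠ true), List.count_cons_self, List.length_cons]
      omega
    · rw [List.count_cons_self, List.count_cons_of_ne (by decide : (true : Bool) ≠ false), List.length_cons]
      omega

/-- **Anti-concentration of the window pop count**: for `ℓ` pairs of any kinds and every target `k`,
`(ℓ + 1) · levelCount² ≤ 16^ℓ`, i.e. the level set has uniform mass `≤ (ℓ+1)^{-1/2}` among the `16^ℓ … = (4^ℓ)²`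
normalisation (from `PopCount.succ_mul_choose_sq_le`: `(t+1) C(t,k)² ≤ 4^t`). [folklore] -/
theorem succ_mul_levelCount_sq_le (κs : List Bool) (k : ℕ) :
    (κs.length + 1) * levelCount κs k ^ 2 ≤ 16 ^ κs.length := by
  rw [levelCount_eq]
  set a := κs.count true
  set b := κs.count false
  have hlen : a + b = κs.length := count_true_add_count_false κs
  have h1 := PopCount.succ_mul_choose_sq_le (a + 2 * b) k
  have h2 : κs.length + 1 ≤ a + 2 * b + 1 := by omega
  calc (κs.length + 1) * (2 ^ a * Nat.choose (a + 2 * b) k) ^ 2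
      = 4 ^ a * ((κs.length + 1) * Nat.choose (a + 2 * b) k ^ 2) := by
        have h4 : (2 ^ a) ^ 2 = 4 ^ a := by rw [← pow_mul, mul_comm, pow_mul]; norm_num
        rw [mul_pow, h4]; ring
    _ ≤ 4 ^ a * ((a + 2 * b + 1) * Nat.choose (a + 2 * b) k ^ 2) := by gcongr
    _ ≤ 4 ^ a * 4 ^ (a + 2 * b) := by gcongr
    _ = 16 ^ κs.length := by
        rw [← pow_add, ← hlen, show a + (a + 2 * b) = 2 * (a + b) by ring, pow_mul]; norm_num

/-- A level count with a witness content is positive: one term of the recursion. [folklore] -/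
theorem levelCount_cons_ge (κ : Bool) (κs : List Bool) {k : ℕ} (b₀ b₁ : Bool) (hc : popPair κ b₀ b₁ ≤ k) :
    levelCount κs (k - popPair κ b₀ b₁) ≤ levelCount (κ :: κs) k := by
  rw [levelCount]
  refine le_trans ?_ (single_le_sum (f := fun c : Bool × Bool =>
    if popPair κ c.1 c.2 ≤ k then levelCount κs (k - popPair κ c.1 c.2) else 0) (fun _ _ => Nat.zero_le _)
    (mem_univ (b₀, b₁)))
  simp only [if_pos hc, le_refl]

/-! ### The window: prefix pop counts, completions, the gate weight -/

variable {J : ℕ}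

/-- Bit `n` of `v` (junk `false` beyond the end). [folklore] -/
def bit (v : Fin (2 * J) → Bool) (n : ℕ) : Bool := if h : n < 2 * J then v ⟨n, h⟩ else false

/-- The pop count of the first `t` pairs `s, …, s+t-1` of the window. [folklore] -/
def popPrefix (κ : ℕ → Bool) (s t : ℕ) (v : Fin (2 * J) → Bool) : ℕ :=
  ∑ i ∈ range t, popPair (κ (s + i)) (bit v (2 * (s + i))) (bit v (2 * (s + i) + 1))

/-- The kinds of the remaining pairs `s+t, …, s+ℓ-1` of the window. [folklore] -/
def kinds (κ : ℕ → Bool) (s ℓ t : ℕ) : List Bool := (List.range' (s + t) (ℓ - t)).map κ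

/-- The number of admissible completions of the window (total pop count `k`) after its first `t` pairs are read off
`v`. [folklore] -/
def completions (κ : ℕ → Bool) (s ℓ k t : ℕ) (v : Fin (2 * J) → Bool) : ℕ :=
  if popPrefix κ s t v ≤ k then levelCount (kinds κ s ℓ t) (k - popPrefix κ s t v) else 0

/-- **The gate weight** of pair `s+t`: the conditional probability, given the first `t` pairs, that a uniform
completion of the window hits the target, AFTER versus BEFORE reading pair `s+t` — `N_{t+1}(v)/N_t(v)` (`0` if
`N_t(v) = 0`). [folklore] -/
def gateWeight (κ : ℕ → Bool) (s ℓ k t : ℕ) (v : Fin (2 * J) → Bool) : ℝ :=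
  if completions κ s ℓ k t v = 0 then 0
  else (completions κ s ℓ k (t + 1) v : ℝ) / (completions κ s ℓ k t v : ℝ)

/-- The gate weight is nonnegative. [folklore] -/
theorem gateWeight_nonneg (κ : ℕ → Bool) (s ℓ k t : ℕ) (v : Fin (2 * J) → Bool) :
    0 ≤ gateWeight κ s ℓ k t v := by unfold gateWeight; split_ifs <;> positivity

/-- The prefix pop count depends on `v` only through the bits `< 2(s+t)`. [folklore] -/
theorem popPrefix_eq_of_agree (κ : ℕ → Bool) (s t : ℕ) {v w : Fin (2 * J) → Bool}
    (h : ∀ i : Fin (2 * J), i.val < 2 * (s + t) → v i = w i) : popPrefix κ s t v = popPrefix κ s t w := by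
  unfold popPrefix
  refine sum_congr rfl fun i hi => ?_
  rw [mem_range] at hi
  have hb : ∀ n, n < 2 * (s + t) → bit v n = bit w n := by
    intro n hn
    unfold bit
    split_ifs with hn'
    · exact h _ hn
    · rfl
  rw [hb _ (by omega), hb _ (by omega)]

/-- The completion count after `t` pairs depends on `v` only through the bits `< 2(s+t)`. [folklore] -/
theorem completions_eq_of_agree (κ : ℕ → Bool) (s ℓ k t : ℕ) {v w : Fin (2 * J) → Bool}
    (h : ∀ i : Fin (2 * J), i.val < 2 * (s + t) → v i = w i) :
    completions κ s ℓ k t v = completions κ s ℓ k t w := by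
  unfold completions
  rw [popPrefix_eq_of_agree κ s t h]

/-- **Past-measurability**: the gate weight of pair `s+t` depends on `v` only through the bits `< 2(s+t)+2`.
[folklore] -/
theorem gateWeight_eq_of_agree (κ : ℕ → Bool) (s ℓ k t : ℕ) {v w : Fin (2 * J) → Bool}
    (h : ∀ i : Fin (2 * J), i.val < 2 * (s + t) + 2 → v i = w i) :
    gateWeight κ s ℓ k t v = gateWeight κ s ℓ k t w := by
  unfold gateWeight
  rw [completions_eq_of_agree κ s ℓ k t (fun i hi => h i (by omega)),
    completions_eq_of_agree κ s ℓ k (t + 1) (fun i hi => h i (by omega))]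

/-- Reading one more pair adds its pops. [folklore] -/
theorem popPrefix_succ (κ : ℕ → Bool) (s t : ℕ) (v : Fin (2 * J) → Bool) :
    popPrefix κ s (t + 1) v = popPrefix κ s t v
      + popPair (κ (s + t)) (bit v (2 * (s + t))) (bit v (2 * (s + t) + 1)) := by
  unfold popPrefix
  rw [sum_range_succ]

/-- Peeling the first remaining kind. [folklore] -/
theorem kinds_eq_cons (κ : ℕ → Bool) (s ℓ t : ℕ) (ht : t < ℓ) :
    kinds κ s ℓ t = κ (s + t) :: kinds κ s ℓ (t + 1) := by
  unfold kinds
  obtain ⟨d, hd⟩ : ∃ d, ℓ - t = d + 1 := ⟨ℓ - t - 1, by omega⟩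
  rw [hd, show ℓ - (t + 1) = d by omega, List.range'_succ, List.map_cons]
  rfl

/-- **Conditional sub-probability**: over the four codes of pair `s+t` (`t < ℓ`, the pair inside the string) the
gate weights sum to at most `1` — exactly `1` if the past admits a completion, `0` otherwise. [folklore] -/
theorem sum_gateWeight_setPair_le (κ : ℕ → Bool) (s ℓ k t : ℕ) (ht : t < ℓ) (hJ : 2 * (s + t) + 1 < 2 * J)
    (v : Fin (2 * J) → Bool) :
    ∑ c : Bool × Bool, gateWeight κ s ℓ k t (fun i : Fin (2 * J) =>
        if i.val = 2 * (s + t) then c.1 else if i.val = 2 * (s + t) + 1 then c.2 else v i) ≤ 1 := by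
  set F : Bool × Bool → (Fin (2 * J) → Bool) := fun c i =>
    if i.val = 2 * (s + t) then c.1 else if i.val = 2 * (s + t) + 1 then c.2 else v i with hF
  show ∑ c : Bool × Bool, gateWeight κ s ℓ k t (F c) ≤ 1
  -- below pair `s+t` the four words agree with `v`
  have hagree : ∀ c, ∀ i : Fin (2 * J), i.val < 2 * (s + t) → F c i = v i := by
    intro c i hi
    simp only [hF]
    rw [if_neg (by omega), if_neg (by omega)]
  have hCt : ∀ c, completions κ s ℓ k t (F c) = completions κ s ℓ k t v := fun c =>
    completions_eq_of_agree κ s ℓ k t (hagree c)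
  have hlt0 : 2 * (s + t) < 2 * J := by omega
  have hne : 2 * (s + t) + 1 ≠ 2 * (s + t) := by omega
  have hbit0 : ∀ c : Bool × Bool, bit (F c) (2 * (s + t)) = c.1 := by
    intro c
    unfold bit; rw [dif_pos hlt0]
    show (if (2 * (s + t) = 2 * (s + t)) then c.1 else
      if (2 * (s + t) = 2 * (s + t) + 1) then c.2 else v ⟨2 * (s + t), hlt0⟩) = c.1
    rw [if_pos rfl]
  have hbit1 : ∀ c : Bool × Bool, bit (F c) (2 * (s + t) + 1) = c.2 := by
    intro c
    unfold bit; rw [dif_pos hJ]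
    show (if (2 * (s + t) + 1 = 2 * (s + t)) then c.1 else
      if (2 * (s + t) + 1 = 2 * (s + t) + 1) then c.2 else v ⟨2 * (s + t) + 1, hJ⟩) = c.2
    rw [if_neg hne, if_pos rfl]
  have hP : ∀ c : Bool × Bool, popPrefix κ s (t + 1) (F c) = popPrefix κ s t v + popPair (κ (s + t)) c.1 c.2 := by
    intro c
    rw [popPrefix_succ, popPrefix_eq_of_agree κ s t (hagree c), hbit0, hbit1]
  by_cases h0 : completions κ s ℓ k t v = 0
  · have : ∀ c, gateWeight κ s ℓ k t (F c) = 0 := by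
      intro c; unfold gateWeight; rw [hCt c, if_pos h0]
    simp only [this, sum_const_zero]
    exact zero_le_one
  · -- the numerators sum to the denominator (the recursion of `levelCount`)
    have hsum : ∑ c : Bool × Bool, (completions κ s ℓ k (t + 1) (F c) : ℝ) = completions κ s ℓ k t v := by
      rw [← Nat.cast_sum]
      congr 1
      have hle : popPrefix κ s t v ≤ k := by
        by_contra hlt
        apply h0
        unfold completions
        rw [if_neg hlt]
      unfold completions
      rw [if_pos hle, kinds_eq_cons κ s ℓ t ht, levelCount]
      refine sum_congr rfl fun c _ => ?_
      rw [hP c]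
      by_cases hc : popPair (κ (s + t)) c.1 c.2 ≤ k - popPrefix κ s t v
      · rw [if_pos (by omega), if_pos hc]
        congr 1
        omega
      · rw [if_neg (by omega), if_neg hc]
    have hpos : (0 : ℝ) < completions κ s ℓ k t v := by exact_mod_cast Nat.pos_of_ne_zero h0
    have : ∑ c : Bool × Bool, gateWeight κ s ℓ k t (F c)
        = (∑ c : Bool × Bool, (completions κ s ℓ k (t + 1) (F c) : ℝ)) / completions κ s ℓ k t v := by
      rw [sum_div]
      refine sum_congr rfl fun c _ => ?_
      unfold gateWeight
      rw [hCt c, if_neg h0]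
    rw [this, hsum, div_self hpos.ne']

/-- Along a word whose window pop count is `k`, the completion counts are positive and non-increasing.
[folklore] -/
theorem completions_succ_le (κ : ℕ → Bool) (s ℓ k : ℕ) (v : Fin (2 * J) → Bool)
    (hk : popPrefix κ s ℓ v = k) {t : ℕ} (ht : t < ℓ) :
    completions κ s ℓ k (t + 1) v ≤ completions κ s ℓ k t v := by
  -- the prefix counts are monotone, hence `≤ k`
  have hmono : ∀ a b, a ≤ b → popPrefix κ s a v ≤ popPrefix κ s b v := by
    intro a b hab
    unfold popPrefix
    exact sum_le_sum_of_subset_of_nonneg (range_subset_range.2 hab) fun _ _ _ => Nat.zero_le _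
  have hle1 : popPrefix κ s (t + 1) v ≤ k := hk ▸ hmono _ _ (by omega)
  have hle0 : popPrefix κ s t v ≤ k := hk ▸ hmono _ _ (by omega)
  unfold completions
  rw [if_pos hle1, if_pos hle0, kinds_eq_cons κ s ℓ t ht]
  have := levelCount_cons_ge (κ (s + t)) (kinds κ s ℓ (t + 1)) (k := k - popPrefix κ s t v)
    (bit v (2 * (s + t))) (bit v (2 * (s + t) + 1)) (by rw [popPrefix_succ] at hle1; omega)
  rw [popPrefix_succ]
  convert this using 2
  omega

/-- At the end of the window the completion count of a hitting word is `1`. [folklore] -/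
theorem completions_self (κ : ℕ → Bool) (s ℓ k : ℕ) (v : Fin (2 * J) → Bool) (hk : popPrefix κ s ℓ v = k) :
    completions κ s ℓ k ℓ v = 1 := by
  unfold completions kinds
  rw [hk, if_pos le_rfl, Nat.sub_self, Nat.sub_self, List.range'_zero, List.map_nil, levelCount, if_pos rfl]

/-- At the start of the window the completion count is the full level count. [folklore] -/
theorem completions_zero (κ : ℕ → Bool) (s ℓ k : ℕ) (v : Fin (2 * J) → Bool) :
    completions κ s ℓ k 0 v = levelCount (kinds κ s ℓ 0) k := by
  unfold completions popPrefix
  rw [sum_range_zero, if_pos (Nat.zero_le _), Nat.sub_zero]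

/-- Positivity of the completion counts along a hitting word. [folklore] -/
theorem completions_pos (κ : ℕ → Bool) (s ℓ k : ℕ) (v : Fin (2 * J) → Bool) (hk : popPrefix κ s ℓ v = k)
    {t : ℕ} (ht : t ≤ ℓ) : 0 < completions κ s ℓ k t v := by
  -- downward induction on the distance `e = ℓ - t` to the end of the window
  suffices H : ∀ e u : ℕ, u + e = ℓ → 0 < completions κ s ℓ k u v from H (ℓ - t) t (by omega)
  intro e
  induction e with
  | zero =>
    intro u hu
    rw [Nat.add_zero] at hu
    subst hu
    rw [completions_self κ s u k v hk]; exact Nat.one_pos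
  | succ e ih =>
    intro u hu
    exact lt_of_lt_of_le (ih (u + 1) (by omega)) (completions_succ_le κ s ℓ k v hk (by omega))

/-- **Telescoping**: along a word whose window pop count is `k`, the product of the `ℓ` gate weights is
`1 / levelCount` (the uniform conditional probability of the whole admissible content). [folklore] -/
theorem prod_gateWeight_eq (κ : ℕ → Bool) (s ℓ k : ℕ) (v : Fin (2 * J) → Bool) (hk : popPrefix κ s ℓ v = k) :
    ∏ t ∈ range ℓ, gateWeight κ s ℓ k t v = 1 / (levelCount (kinds κ s ℓ 0) k : ℝ) := by
  have hpos : ∀ t ≤ ℓ, (0 : ℝ) < completions κ s ℓ k t v := fun t ht => by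
    exact_mod_cast completions_pos κ s ℓ k v hk ht
  -- `∏_{t<u} w_t = N_u / N_0`
  have key : ∀ u ≤ ℓ, ∏ t ∈ range u, gateWeight κ s ℓ k t v
      = (completions κ s ℓ k u v : ℝ) / completions κ s ℓ k 0 v := by
    intro u hu
    induction u with
    | zero => rw [prod_range_zero, div_self (hpos 0 (Nat.zero_le _)).ne']
    | succ u ih =>
      rw [prod_range_succ, ih (by omega)]
      have hu0 : (completions κ s ℓ k u v : ℝ) ≠ 0 := (hpos u (by omega)).ne'
      have h00 : (completions κ s ℓ k 0 v : ℝ) ≠ 0 := (hpos 0 (Nat.zero_le _)).ne'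
      have hne : completions κ s ℓ k u v ≠ 0 := by exact_mod_cast hu0
      unfold gateWeight
      rw [if_neg hne, div_mul_div_comm, mul_comm (completions κ s ℓ k u v : ℝ),
        mul_div_mul_right _ _ hu0]
  rw [key ℓ le_rfl, completions_self κ s ℓ k v hk, completions_zero, Nat.cast_one]

/-- **The price of a passed gate**: along a word whose window pop count hits the target, the product of the gate
weights is at least `√(ℓ+1) / 4^ℓ` — a factor `√(ℓ+1)` above the free-pair weight `4^{-ℓ}`, so that in
`CondProb.card_mul_le_one_of_condWeight` each passed gate of length `ℓ` divides the word count by `√(ℓ+1)`.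
[folklore] -/
theorem sqrt_div_le_prod_gateWeight (κ : ℕ → Bool) (s ℓ k : ℕ) (v : Fin (2 * J) → Bool)
    (hk : popPrefix κ s ℓ v = k) :
    Real.sqrt (ℓ + 1) / 4 ^ ℓ ≤ ∏ t ∈ range ℓ, gateWeight κ s ℓ k t v := by
  rw [prod_gateWeight_eq κ s ℓ k v hk]
  set N := levelCount (kinds κ s ℓ 0) k with hN
  have hlen : (kinds κ s ℓ 0).length = ℓ := by simp [kinds]
  have hNpos : 0 < N := by
    have := completions_pos κ s ℓ k v hk (Nat.zero_le ℓ)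
    rwa [completions_zero] at this
  have hsq : ((ℓ : ℝ) + 1) * (N : ℝ) ^ 2 ≤ (16 : ℝ) ^ ℓ := by
    have := succ_mul_levelCount_sq_le (kinds κ s ℓ 0) k
    rw [hlen] at this
    exact_mod_cast this
  have hNr : (0 : ℝ) < N := by exact_mod_cast hNpos
  have h4 : (0 : ℝ) < 4 ^ ℓ := by positivity
  have hmain : Real.sqrt (ℓ + 1) * N ≤ 4 ^ ℓ := by
    have h16 : (16 : ℝ) ^ ℓ = (4 ^ ℓ) ^ 2 := by rw [← pow_mul, mul_comm, pow_mul]; norm_num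
    rw [h16] at hsq
    have hnn : 0 ≤ Real.sqrt (ℓ + 1) * N := by positivity
    have hsq' : (Real.sqrt (ℓ + 1) * N) ^ 2 ≤ (4 ^ ℓ) ^ 2 := by
      rw [mul_pow, Real.sq_sqrt (by positivity)]
      exact hsq
    exact (pow_le_pow_iff_left₀ hnn h4.le two_ne_zero).1 hsq'
  rw [div_le_div_iff₀ h4 hNr, one_mul]
  exact hmain

end Summit.ValiantsHypothesis.ValiantsHypothesis.Theorems.FifoMatching.NNLinearDegreeCofactorHard.GateWeight

end
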